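import Summits.QuantumFields.YangMills.Theorems.SwapVirialDeficitBlowUpGnomonicTipRotLetters
import HarnessLib

/-!
# The EXACT transverse sizes of the rotated tip letters (uniform in the joint tilt)

Sub-problem `SwapVirialDeficit`, crux ⟨stmt-QuantumFields-24197⟩ `SwapGluedStiffness`, skeleton ➎, stub `stub_core_tip`, socket (hCore), step S0′ of w3 g68's
(C2-asm) list (STATUS 01:36Z).  For the rotated tip point `ζ = gnoBase (λx₀) (λy₀) + gnoRot ū stiff` of ✓`tipRot_letters` (`rot3 u e₀ = (1,τ)/λ`,
`λ = √(1+|τ|²)`, `stiff = ((0,−y₀ρ), (0,x₀ρ), z, F)`) the transverse parts are, EXACTLY,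
`|ζ.x⊥|² = (y₀²/λ²)·(|ρ|² + (τ×ρ)²)`, `|ζ.y⊥|² = (x₀²/λ²)·(|ρ|² + (τ×ρ)²)`
(✓`tipRot_letters_compressed` only gave `≤ y₀²|ρ|²`, which is NOT uniform in `λ` against the commutator floor; with the full cross-product floor
✓`gnoDeficit_floor_cross` — `4|p|⁴(|ρ|²+(τ×ρ)²)/((1+|x|²)(1+|y|²)) ≤ 1800L⁶F̂` — the present identity gives
`|ζ.x⊥|²/(1+|ζ.x|²) ≤ 450L⁶F̂·y₀²(1+|y|²)/(λ²|p|⁴)`, uniform in the joint tilt).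
* `dot3_rot3` — `rot3 u` preserves the dot product (polarisation of ✓`normSq3_rot3` with ✓`rot3_add`);
* `rot3_star_apply_zero` — `(rot3 ū w)₀ = ⟨rot3 u e₀, w⟩`;
* `transverse_sq_rot3_star` — `(rot3 ū w)₁² + (rot3 ū w)₂² = |w|² − ⟨rot3 u e₀, w⟩²`;
* ★ `tipRot_transverse_sq` — the two identities above.

HONEST LABEL: letter bookkeeping only; (hCore), `stub_core_tip`, ⟨24197⟩, ⟨24194⟩ remain OPEN; nothing here proves the Yang–Mills mass gap.
-/

noncomputable section

open Quaternion Set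
open scoped Quaternion BigOperators
open Literature.MathematicalPhysics.QuantumLattice
open Literature.MathematicalPhysics.QuantumFieldTheory hiding SU2

namespace Summit.QuantumFields.YangMills.Theorems.SwapVirialDeficit.BlowUpRing

open Summit.QuantumFields.YangMills.Theorems.FemtoTransferGap
open Summit.QuantumFields.YangMills.Theorems.FemtoTransferGap.TT
open Summit.QuantumFields.YangMills.Theorems.SwapVirialDeficit.Gnomonic (normSq3)

variable {L : ℕ} [NeZero L]

omit [NeZero L] in
/-- `rot3 u` (unit `u`) preserves the dot product: `Σ (rot3 u a)ᵢ(rot3 u b)ᵢ = Σ aᵢbᵢ`. [folklore] -/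
theorem dot3_rot3 {u : ℍ} (hu : ‖u‖ = 1) (a b : Fin 3 → ℝ) : ∑ i, rot3 u a i * rot3 u b i = ∑ i, a i * b i := by
  have hab := normSq3_rot3 hu (a + b)
  have ha := normSq3_rot3 hu a
  have hb := normSq3_rot3 hu b
  rw [rot3_add] at hab
  rw [normSq3_eq_three', normSq3_eq_three'] at hab ha hb
  simp only [Pi.add_apply] at hab
  rw [Fin.sum_univ_three, Fin.sum_univ_three]
  nlinarith [hab, ha, hb]

omit [NeZero L] in
/-- `(rot3 ū w)₀ = ⟨rot3 u e₀, w⟩` for a unit `u`. [folklore] -/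
theorem rot3_star_apply_zero {u : ℍ} (hu : ‖u‖ = 1) (w : Fin 3 → ℝ) : rot3 (star u) w 0 = ∑ i, rot3 u ![1, 0, 0] i * w i := by
  have hsu : ‖star u‖ = 1 := by rw [Quaternion.norm_star]; exact hu
  have hback : rot3 u (rot3 (star u) w) = w := by
    rw [rot3_rot3 hu hsu, show star u * u = 1 from ?_, rot3_one]
    have h := Quaternion.star_mul_self u
    rw [Quaternion.normSq_eq_norm_mul_self, hu, mul_one, Quaternion.coe_one] at h
    exact h
  have h := dot3_rot3 hu ![1, 0, 0] (rot3 (star u) w)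
  rw [hback] at h
  rw [h, Fin.sum_univ_three]
  simp

omit [NeZero L] in
/-- The transverse part of `rot3 ū w`: `(rot3 ū w)₁² + (rot3 ū w)₂² = |w|² − ⟨rot3 u e₀, w⟩²`. [folklore] -/
theorem transverse_sq_rot3_star {u : ℍ} (hu : ‖u‖ = 1) (w : Fin 3 → ℝ) :
    (rot3 (star u) w 1) ^ 2 + (rot3 (star u) w 2) ^ 2 = normSq3 w - (∑ i, rot3 u ![1, 0, 0] i * w i) ^ 2 := by
  have hsu : ‖star u‖ = 1 := by rw [Quaternion.norm_star]; exact hu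
  have hn := normSq3_rot3 hsu w
  rw [normSq3_eq_three'] at hn
  rw [← rot3_star_apply_zero hu w, ← hn]
  ring

omit [NeZero L] in
/-- ★ **THE EXACT ROTATED TRANSVERSE SIZES**: if `rot3 u e₀ = (1,τ)/λ` (`λ = √(1+|τ|²)`), then for the point `ζ` of ✓`tipRot_letters`
`|ζ.x⊥|² = (y₀²/λ²)·(|ρ|² + (τ×ρ)²)` and `|ζ.y⊥|² = (x₀²/λ²)·(|ρ|² + (τ×ρ)²)`. [folklore] -/
theorem tipRot_transverse_sq {u : ℍ} (hu : ‖u‖ = 1) (p : ℝ × ℝ) (τ ρ : Fin 2 → ℝ)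
    (hrot : rot3 u ![1, 0, 0] = (Real.sqrt (1 + (τ 0 ^ 2 + τ 1 ^ 2)))⁻¹ • (![1, τ 0, τ 1] : Fin 3 → ℝ)) (z : Fin 3 → ℝ) (F : Fol L → Fin 3 → ℝ) :
    ((gnoBase (Real.sqrt (1 + (τ 0 ^ 2 + τ 1 ^ 2)) * p.1) (Real.sqrt (1 + (τ 0 ^ 2 + τ 1 ^ 2)) * p.2) +
          gnoRot (star u) ((((![0, -(p.2 * ρ 0), -(p.2 * ρ 1)] : Fin 3 → ℝ), (![0, p.1 * ρ 0, p.1 * ρ 1] : Fin 3 → ℝ)), (z, F)) : GnoCoord L)).1.1 1) ^ 2 +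
        ((gnoBase (Real.sqrt (1 + (τ 0 ^ 2 + τ 1 ^ 2)) * p.1) (Real.sqrt (1 + (τ 0 ^ 2 + τ 1 ^ 2)) * p.2) +
          gnoRot (star u) ((((![0, -(p.2 * ρ 0), -(p.2 * ρ 1)] : Fin 3 → ℝ), (![0, p.1 * ρ 0, p.1 * ρ 1] : Fin 3 → ℝ)), (z, F)) : GnoCoord L)).1.1 2) ^ 2 =
        p.2 ^ 2 / (1 + (τ 0 ^ 2 + τ 1 ^ 2)) * ((ρ 0 ^ 2 + ρ 1 ^ 2) + (τ 0 * ρ 1 - τ 1 * ρ 0) ^ 2) ∧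
      ((gnoBase (Real.sqrt (1 + (τ 0 ^ 2 + τ 1 ^ 2)) * p.1) (Real.sqrt (1 + (τ 0 ^ 2 + τ 1 ^ 2)) * p.2) +
          gnoRot (star u) ((((![0, -(p.2 * ρ 0), -(p.2 * ρ 1)] : Fin 3 → ℝ), (![0, p.1 * ρ 0, p.1 * ρ 1] : Fin 3 → ℝ)), (z, F)) : GnoCoord L)).1.2 1) ^ 2 +
        ((gnoBase (Real.sqrt (1 + (τ 0 ^ 2 + τ 1 ^ 2)) * p.1) (Real.sqrt (1 + (τ 0 ^ 2 + τ 1 ^ 2)) * p.2) +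
          gnoRot (star u) ((((![0, -(p.2 * ρ 0), -(p.2 * ρ 1)] : Fin 3 → ℝ), (![0, p.1 * ρ 0, p.1 * ρ 1] : Fin 3 → ℝ)), (z, F)) : GnoCoord L)).1.2 2) ^ 2 =
        p.1 ^ 2 / (1 + (τ 0 ^ 2 + τ 1 ^ 2)) * ((ρ 0 ^ 2 + ρ 1 ^ 2) + (τ 0 * ρ 1 - τ 1 * ρ 0) ^ 2) := by
  set lam : ℝ := Real.sqrt (1 + (τ 0 ^ 2 + τ 1 ^ 2)) with hlam
  have hlam0 : 0 < lam := Real.sqrt_pos.2 (by positivity)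
  have hlam2 : lam ^ 2 = 1 + (τ 0 ^ 2 + τ 1 ^ 2) := Real.sq_sqrt (by positivity)
  set sx : Fin 3 → ℝ := ![0, -(p.2 * ρ 0), -(p.2 * ρ 1)] with hsx
  set sy : Fin 3 → ℝ := ![0, p.1 * ρ 0, p.1 * ρ 1] with hsy
  have ex1 : (gnoBase (lam * p.1) (lam * p.2) + gnoRot (star u) (((sx, sy), (z, F)) : GnoCoord L)).1.1 1 = rot3 (star u) sx 1 := by
    show (![lam * p.1, 0, 0] : Fin 3 → ℝ) 1 + rot3 (star u) sx 1 = _; simp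
  have ex2 : (gnoBase (lam * p.1) (lam * p.2) + gnoRot (star u) (((sx, sy), (z, F)) : GnoCoord L)).1.1 2 = rot3 (star u) sx 2 := by
    show (![lam * p.1, 0, 0] : Fin 3 → ℝ) 2 + rot3 (star u) sx 2 = _; simp
  have ey1 : (gnoBase (lam * p.1) (lam * p.2) + gnoRot (star u) (((sx, sy), (z, F)) : GnoCoord L)).1.2 1 = rot3 (star u) sy 1 := by
    show (![lam * p.2, 0, 0] : Fin 3 → ℝ) 1 + rot3 (star u) sy 1 = _; simp
  have ey2 : (gnoBase (lam * p.1) (lam * p.2) + gnoRot (star u) (((sx, sy), (z, F)) : GnoCoord L)).1.2 2 = rot3 (star u) sy 2 := by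
    show (![lam * p.2, 0, 0] : Fin 3 → ℝ) 2 + rot3 (star u) sy 2 = _; simp
  have hdx : ∑ i, rot3 u ![1, 0, 0] i * sx i = -(lam⁻¹ * (p.2 * (τ 0 * ρ 0 + τ 1 * ρ 1))) := by
    rw [hrot, hsx, Fin.sum_univ_three]; simp; ring
  have hdy : ∑ i, rot3 u ![1, 0, 0] i * sy i = lam⁻¹ * (p.1 * (τ 0 * ρ 0 + τ 1 * ρ 1)) := by
    rw [hrot, hsy, Fin.sum_univ_three]; simp; ring
  have nsx : normSq3 sx = p.2 ^ 2 * (ρ 0 ^ 2 + ρ 1 ^ 2) := by rw [hsx, normSq3_eq_three']; simp; ring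
  have nsy : normSq3 sy = p.1 ^ 2 * (ρ 0 ^ 2 + ρ 1 ^ 2) := by rw [hsy, normSq3_eq_three']; simp; ring
  have hl2 : lam⁻¹ ^ 2 = (1 + (τ 0 ^ 2 + τ 1 ^ 2))⁻¹ := by rw [inv_pow, hlam2]
  have key : ∀ c : ℝ, c ^ 2 * (ρ 0 ^ 2 + ρ 1 ^ 2) - (lam⁻¹ * (c * (τ 0 * ρ 0 + τ 1 * ρ 1))) ^ 2 =
      c ^ 2 / (1 + (τ 0 ^ 2 + τ 1 ^ 2)) * ((ρ 0 ^ 2 + ρ 1 ^ 2) + (τ 0 * ρ 1 - τ 1 * ρ 0) ^ 2) := fun c => by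
    have e : (lam⁻¹ * (c * (τ 0 * ρ 0 + τ 1 * ρ 1))) ^ 2 = lam⁻¹ ^ 2 * (c ^ 2 * (τ 0 * ρ 0 + τ 1 * ρ 1) ^ 2) := by ring
    rw [e, hl2, div_eq_mul_inv]
    have hpos : (1 + (τ 0 ^ 2 + τ 1 ^ 2)) ≠ 0 := by positivity
    field_simp
    ring
  refine ⟨?_, ?_⟩
  · rw [ex1, ex2, transverse_sq_rot3_star hu sx, hdx, nsx, neg_sq]; exact key p.2
  · rw [ey1, ey2, transverse_sq_rot3_star hu sy, hdy, nsy]; exact key p.1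

end Summit.QuantumFields.YangMills.Theorems.SwapVirialDeficit.BlowUpRing

end
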